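import Summits.HodgeConjecture.CorCM.GaloisCyclicSemidirectEightNormPairCoefficients
import HarnessLib

/-!
# The converse model theorem for `C_p ⋊ C₈`: no `μ₄`-norm pair in `ℤ/p` ⟹ no annihilator

COR-CM (cell `pub-hodgecm2`), binder seat b04 (gen 29), count-neutral claim CYCLIC-SEMIDIRECT-EIGHT-DEGENERATE, part VIIIb.
KERNEL ONLY: theorems; no definition, no named fact, no `sorry`.  `HC_CM` is neither used nor claimed.

Part I (`CorCM/GaloisCyclicSemidirectEightTwoSheet`) proved the model theorem of `G₀ = C_p ⋊ C₈` under the FIELD hypothesis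
«`±i` is not a quotient of norms `z ρ(z)`» (true iff `p ≡ 5 (mod 8)`); part V (`…NormPairs`) proved that a `μ₄`-NORM PAIR in
`ℤ/p` (two sheets `k₀, k₁ : ℤ/p → ℤ/4` with the two balance identities, `k₀` non-constant) produces a primitive DEGENERATE
type.  **`eq_zero_of_annihilated_of_forall_normPair_const`** closes the circle: if NO such pair exists (`hNP`: the balance
identities force `k₀` constant), then for every CM set `S ⊆ G₀` (for `c₀ = y⁴`) of which `u⁴` is not a left stabiliser,
every `c₀`-antisymmetric `b : G₀ → ℚ` annihilated by the right translates of `S` vanishes — i.e. (gen 20's criterion) every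
primitive CM type is nondegenerate.  Proof: by gen 20's two-sheet annihilator theorem it suffices that no odd character
`χ = ψ_α ⊗ ψ_β` (`α = ±i`) has a singular block `Ŝ₁(χ)Ŝ₁(χθ) − α Ŝ₂(χ)Ŝ₂(χθ) = (1+α)²(G₀(β)G₀(β⁻¹) − α G₁(β)G₁(β⁻¹))`;
for `β = 1` this is part VIIIa's parity lemma; for `β ≠ 1` (a primitive `p`-th root of unity) a singular block is a norm
pair (VIIIa), so `k₀` is constant, `G₀(β) = α^{k₀}·Σ_v β^v = 0`, hence `G₁(β)G₁(β⁻¹) = 0` and `k₁` is constant too (VIIIa);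
but then `C_p = ⟨u⟩` stabilises `S`, contradicting the hypothesis on `u⁴`.

## References

* [Kubota1965] T. Kubota, *On the field extension by complex multiplication*, Trans. AMS 118 (1965), §4 Lemma 2.
* [Dodson1984] B. Dodson, *The structure of Galois groups of CM-fields*, Trans. AMS 283 (1984), §3.1, §5.3.
* [Washington1997] L. C. Washington, *Introduction to Cyclotomic Fields*, 2nd ed., GTM 83, Thm. 2.5.
-/

noncomputable section

open scoped BigOperators

namespace Summit.HodgeConjecture.CorCM.GaloisCyclicSemidirectEight

open Literature.NumberTheory.ComplexMultiplication (IsCMTypeWith)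
open Summit.HodgeConjecture.CorCM.GaloisQuaternionCyclic (omega_mul_omega)
open Summit.HodgeConjecture.CorCM.CyclotomicGaussian (eq_of_sum_gaussian_mul_pow_eq_zero)
open AddChar
open Multiplicative (ofAdd toAdd)

/-! ## §4 The model theorem: no `μ₄`-norm pair ⟹ no annihilator -/

section Model

variable {p : ℕ} [Fact p.Prime]

/-- **THE CONVERSE MODEL THEOREM.**  `p` an odd prime, `G₀ = C_p ⋊ C₈` (`φ(1)` = inversion).  Suppose `ℤ/p` carries NO
`μ₄`-NORM PAIR with non-constant first sheet: for all `k₀, k₁ : ℤ/p → ℤ/4` the two balance identities of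
`CorCM/GaloisCyclicSemidirectEightNormPairs` force `k₀` to be constant (`hNP`).  If `S ⊆ G₀` is a CM set for `c₀ = inr 4 = y⁴`
and `u⁴ = inl 4` is not a left stabiliser of `S`, then every `c₀`-antisymmetric `b : G₀ → ℚ` annihilated by all right
translates of `S` is zero.  (The block of an odd character `χ = ψ_α ⊗ ψ_β` is never singular: for `β = 1` by parity, for
`β ≠ 1` a singular block is a norm pair in the sheets `(k₀, k₁)` of `S` by the `ℚ(i)`-independence of the `p`-th roots of
unity, so `k₀` is constant, then `G₀(β) = 0` kills `G₁(β)G₁(β⁻¹)`, so `k₁` is constant too and `C_p` stabilises `S`.)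
[cite: Kubota1965, §4 Lemma 2] [cite: Washington1997, Thm. 2.5] -/
theorem eq_zero_of_annihilated_of_forall_normPair_const (hp2 : p ≠ 2)
    (φ : Multiplicative (ZMod 8) →* MulAut (Multiplicative (ZMod p)))
    (hφ : ∀ v : Multiplicative (ZMod p), φ (Multiplicative.ofAdd 1) v = v⁻¹)
    (hNP : ∀ k₀ k₁ : ZMod p → ZMod 4,
      (∀ d : ZMod p,
        (Finset.univ.filter fun v => k₀ v + k₀ (v - d) = 0).card +
              (Finset.univ.filter fun v => k₁ v + k₁ (v - d) = 1).card +
            (Finset.univ.filter fun v => k₀ v + k₀ v = 2).card + (Finset.univ.filter fun v => k₁ v + k₁ v = 3).card =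
          (Finset.univ.filter fun v => k₀ v + k₀ v = 0).card + (Finset.univ.filter fun v => k₁ v + k₁ v = 1).card +
              (Finset.univ.filter fun v => k₀ v + k₀ (v - d) = 2).card +
            (Finset.univ.filter fun v => k₁ v + k₁ (v - d) = 3).card) →
      (∀ d : ZMod p,
        (Finset.univ.filter fun v => k₀ v + k₀ (v - d) = 1).card +
              (Finset.univ.filter fun v => k₁ v + k₁ (v - d) = 2).card +
            (Finset.univ.filter fun v => k₀ v + k₀ v = 3).card + (Finset.univ.filter fun v => k₁ v + k₁ v = 0).card =
          (Finset.univ.filter fun v => k₀ v + k₀ v = 1).card + (Finset.univ.filter fun v => k₁ v + k₁ v = 2).card +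
              (Finset.univ.filter fun v => k₀ v + k₀ (v - d) = 3).card +
            (Finset.univ.filter fun v => k₁ v + k₁ (v - d) = 0).card) →
      ∀ v, k₀ v = k₀ 0)
    (S : Finset (Multiplicative (ZMod p) ⋊[φ] Multiplicative (ZMod 8)))
    (hScm : ∀ g, SemidirectProduct.inr (Multiplicative.ofAdd (4 : ZMod 8)) * g ∈ S ↔ g ∉ S)
    (hstab : ¬ ∀ w, w ∈ S ↔ SemidirectProduct.inl (Multiplicative.ofAdd (4 : ZMod p)) * w ∈ S)
    (b : Multiplicative (ZMod p) ⋊[φ] Multiplicative (ZMod 8) → ℚ)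
    (hb : ∀ g, b (SemidirectProduct.inr (Multiplicative.ofAdd (4 : ZMod 8)) * g) = -b g)
    (hann : ∀ g, ∑ s ∈ S, b (s * g) = 0) : b = 0 := by
  classical
  have hp : p.Prime := Fact.out
  haveI : NeZero p := ⟨hp.ne_zero⟩
  haveI : Fact (1 < p) := ⟨hp.one_lt⟩
  haveI : Fintype (Multiplicative (ZMod p) ⋊[φ] Multiplicative (ZMod 8)) :=
    Fintype.ofEquiv _ SemidirectProduct.equivProd.symm
  -- ===== the two-sheet structure of `C_p ⋊ C₈` (as in part I `CorCM/GaloisCyclicSemidirectEightTwoSheet`) =====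
  have h24 : Multiplicative.ofAdd (2 : ZMod 8) ^ 4 = 1 := by
    rw [← ofAdd_nsmul]; decide
  let f : Multiplicative (ZMod (2 * 2)) × Multiplicative (ZMod p) →
      Multiplicative (ZMod p) ⋊[φ] Multiplicative (ZMod 8) :=
    fun w => ⟨w.2, Multiplicative.ofAdd (2 : ZMod 8) ^ (Multiplicative.toAdd w.1).val⟩
  have hf_apply : ∀ w, f w = ⟨w.2, Multiplicative.ofAdd (2 : ZMod 8) ^ (Multiplicative.toAdd w.1).val⟩ :=
    fun w => rfl
  let i : Multiplicative (ZMod (2 * 2)) × Multiplicative (ZMod p) →*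
      Multiplicative (ZMod p) ⋊[φ] Multiplicative (ZMod 8) :=
    MonoidHom.mk' f fun w w' => by
      refine SemidirectProduct.ext ?_ ?_
      · simp only [hf_apply, SemidirectProduct.mul_left, Prod.snd_mul, phi_two_pow φ hφ]
      · simp only [hf_apply, SemidirectProduct.mul_right, Prod.fst_mul, toAdd_mul, ← pow_add]
        rw [ZMod.val_add, ← pow_eq_pow_mod _ h24]
  have hi_apply : ∀ w, i w = ⟨w.2, Multiplicative.ofAdd (2 : ZMod 8) ^ (Multiplicative.toAdd w.1).val⟩ :=
    fun w => rfl
  have hval4 : ∀ t : Multiplicative (ZMod (2 * 2)), (Multiplicative.toAdd t).val < 4 := fun t => ZMod.val_lt _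
  have hpow2 : ∀ k : ℕ, Multiplicative.ofAdd (2 : ZMod 8) ^ k = Multiplicative.ofAdd ((2 * k : ℕ) : ZMod 8) :=
    fun k => by rw [← ofAdd_nsmul, nsmul_eq_mul, Nat.cast_mul, Nat.cast_ofNat, mul_comm]
  have hinj2 : ∀ k k' : ℕ, k < 4 → k' < 4 →
      Multiplicative.ofAdd (2 : ZMod 8) ^ k = Multiplicative.ofAdd (2 : ZMod 8) ^ k' → k = k' := by
    intro k k' hk hk' h
    rw [hpow2, hpow2, Equiv.apply_eq_iff_eq, ZMod.natCast_eq_natCast_iff'] at h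
    omega
  have hne1 : ∀ k : ℕ, Multiplicative.ofAdd (2 : ZMod 8) ^ k ≠ Multiplicative.ofAdd 1 := by
    intro k h
    rw [hpow2, Equiv.apply_eq_iff_eq, show (1 : ZMod 8) = ((1 : ℕ) : ZMod 8) by norm_num,
      ZMod.natCast_eq_natCast_iff'] at h
    omega
  have hi : Function.Injective i := by
    rintro ⟨t, v⟩ ⟨t', v'⟩ h
    rw [hi_apply, hi_apply, SemidirectProduct.ext_iff] at h
    refine Prod.ext ?_ h.1
    have := hinj2 _ _ (hval4 t) (hval4 t') h.2
    exact Multiplicative.toAdd.injective (ZMod.val_injective _ this)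
  set y : Multiplicative (ZMod p) ⋊[φ] Multiplicative (ZMod 8) :=
    SemidirectProduct.inr (Multiplicative.ofAdd (1 : ZMod 8)) with hy_def
  have hy : y = ⟨1, Multiplicative.ofAdd 1⟩ := rfl
  have hx : ∀ w, i w ≠ y := fun ⟨t, v⟩ h => by
    rw [hi_apply, hy, SemidirectProduct.ext_iff] at h
    exact hne1 _ h.2
  have hcov : ∀ g : Multiplicative (ZMod p) ⋊[φ] Multiplicative (ZMod 8), (∃ w, g = i w) ∨ (∃ w, g = i w * y) := by
    rintro ⟨v, m⟩
    set n : ℕ := (Multiplicative.toAdd m).val with hn_def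
    have hn8 : n < 8 := ZMod.val_lt _
    have hk4 : ((n / 2 : ℕ) : ZMod (2 * 2)).val = n / 2 := ZMod.val_natCast_of_lt (by omega)
    have hm : m = Multiplicative.ofAdd (2 : ZMod 8) ^ (n / 2) * Multiplicative.ofAdd (1 : ZMod 8) ^ (n % 2) := by
      rw [← ofAdd_nsmul, ← ofAdd_nsmul, ← ofAdd_add, nsmul_eq_mul, nsmul_eq_mul]
      conv_lhs => rw [← ofAdd_toAdd m, ← ZMod.natCast_zmod_val (Multiplicative.toAdd m)]
      rw [← hn_def, ← Nat.div_add_mod n 2]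
      congr 1
      have e : (2 * (n / 2) + n % 2) / 2 = n / 2 := by omega
      have e' : (2 * (n / 2) + n % 2) % 2 = n % 2 := by omega
      rw [e, e']
      push_cast
      ring
    rcases Nat.mod_two_eq_zero_or_one n with h0 | h1
    · refine Or.inl ⟨(Multiplicative.ofAdd ((n / 2 : ℕ) : ZMod (2 * 2)), v), ?_⟩
      rw [hi_apply, toAdd_ofAdd, hk4, hm, h0, pow_zero, mul_one]
    · refine Or.inr ⟨(Multiplicative.ofAdd ((n / 2 : ℕ) : ZMod (2 * 2)), v), ?_⟩
      rw [hi_apply, toAdd_ofAdd, hk4, hy, SemidirectProduct.mul_def]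
      refine SemidirectProduct.ext ?_ ?_
      · simp
      · simpa [h1] using hm
  let θ : Multiplicative (ZMod (2 * 2)) × Multiplicative (ZMod p) ≃*
      Multiplicative (ZMod (2 * 2)) × Multiplicative (ZMod p) :=
    MulEquiv.prodCongr (MulEquiv.refl _) (MulEquiv.inv _)
  have hθ_apply : ∀ w, θ w = (w.1, w.2⁻¹) := fun w => rfl
  have hθ : ∀ w, y * i w = i (θ w) * y := fun ⟨t, v⟩ => by
    rw [hi_apply, hi_apply, hθ_apply, hy, SemidirectProduct.mul_def, SemidirectProduct.mul_def]
    refine SemidirectProduct.ext ?_ ?_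
    · simp [hφ]
    · simp [mul_comm]
  set q : Multiplicative (ZMod (2 * 2)) × Multiplicative (ZMod p) := (Multiplicative.ofAdd 1, 1) with hq_def
  have h1val : (1 : ZMod (2 * 2)).val = 1 := by decide
  have h2val : (2 : ZMod (2 * 2)).val = 2 := by decide
  have hyy : y * y = i q := by
    rw [hi_apply, hq_def, toAdd_ofAdd, h1val, pow_one, hy, SemidirectProduct.mul_def]
    refine SemidirectProduct.ext ?_ ?_
    · simp
    · change Multiplicative.ofAdd (1 : ZMod 8) * Multiplicative.ofAdd 1 = Multiplicative.ofAdd 2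
      rw [← ofAdd_add]; norm_num
  set c : Multiplicative (ZMod (2 * 2)) × Multiplicative (ZMod p) := (Multiplicative.ofAdd 2, 1) with hc_def
  have hic : i c = SemidirectProduct.inr (Multiplicative.ofAdd (4 : ZMod 8)) := by
    rw [hi_apply, hc_def, toAdd_ofAdd, h2val, hpow2]
    rfl
  have h22 : (2 : ZMod (2 * 2)) + 2 = 0 := by decide
  have hcc : c * c = 1 := by
    rw [hc_def, Prod.mk_mul_mk, mul_one, ← ofAdd_add, h22]; rfl
  have hθc : θ c = c := by rw [hθ_apply, hc_def, inv_one]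
  set S₁ : Finset (Multiplicative (ZMod (2 * 2)) × Multiplicative (ZMod p)) :=
    Finset.univ.filter fun w => i w ∈ S with hS₁_def
  set S₂ : Finset (Multiplicative (ZMod (2 * 2)) × Multiplicative (ZMod p)) :=
    Finset.univ.filter fun w => i w * y ∈ S with hS₂_def
  have hS₁ : ∀ w, w ∈ S₁ ↔ i w ∈ S := fun w => by simp [hS₁_def]
  have hS₂ : ∀ w, w ∈ S₂ ↔ i w * y ∈ S := fun w => by simp [hS₂_def]
  -- the CM relations on the sheets: `c w ∈ Sⱼ ↔ w ∉ Sⱼ`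
  have hS₁c : ∀ w, c * w ∈ S₁ ↔ w ∉ S₁ := fun w => by rw [hS₁, hS₁, map_mul, hic, hScm]
  have hS₂c : ∀ w, c * w ∈ S₂ ↔ w ∉ S₂ := fun w => by rw [hS₂, hS₂, map_mul, hic, mul_assoc, hScm]
  -- the stabilising element `γ⁴ = (0, 4) ↦ u⁴ = inl 4`
  have h40 : (4 : ZMod (2 * 2)) = 0 := by decide
  set γ4 : Multiplicative (ZMod (2 * 2)) × Multiplicative (ZMod p) :=
    ((1 : Multiplicative (ZMod (2 * 2))), Multiplicative.ofAdd (4 : ZMod p)) with hγ4_def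
  have hγ4 : i γ4 = SemidirectProduct.inl (Multiplicative.ofAdd (4 : ZMod p)) := by
    rw [hi_apply, hγ4_def, toAdd_one, ZMod.val_zero, pow_zero]
    rfl
  have hcomm : ∀ w, i γ4 * i w = i (w * γ4) := fun w => by rw [← map_mul, mul_comm w]
  -- ===== the sheets `k₀, k₁` of `S` =====
  have hex : ∀ (T : Finset (Multiplicative (ZMod (2 * 2)) × Multiplicative (ZMod p)))
      (hT : ∀ w, c * w ∈ T ↔ w ∉ T) (x : ZMod p),
      ∃ k : ZMod (2 * 2), ∀ t : ZMod (2 * 2), (ofAdd t, ofAdd x) ∈ T ↔ (t = k ∨ t = k + 1) := fun T hT x => by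
    refine sheet_of_cm _ fun t => ?_
    have h := hT (ofAdd t, ofAdd x)
    rwa [hc_def, Prod.mk_mul_mk, one_mul, ← ofAdd_add, add_comm] at h
  choose k₀ hk₀ using hex S₁ hS₁c
  choose k₁ hk₁ using hex S₂ hS₂c
  have hmem₀ : ∀ w : Multiplicative (ZMod (2 * 2)) × Multiplicative (ZMod p),
      w ∈ S₁ ↔ (toAdd w.1 = k₀ (toAdd w.2) ∨ toAdd w.1 = k₀ (toAdd w.2) + 1) := fun ⟨t, x⟩ => by
    have h := hk₀ (toAdd x) (toAdd t); rwa [ofAdd_toAdd, ofAdd_toAdd] at h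
  have hmem₁ : ∀ w : Multiplicative (ZMod (2 * 2)) × Multiplicative (ZMod p),
      w ∈ S₂ ↔ (toAdd w.1 = k₁ (toAdd w.2) ∨ toAdd w.1 = k₁ (toAdd w.2) + 1) := fun ⟨t, x⟩ => by
    have h := hk₁ (toAdd x) (toAdd t); rwa [ofAdd_toAdd, ofAdd_toAdd] at h
  -- graphs
  set gr : (ZMod p → ZMod (2 * 2)) → Finset (Multiplicative (ZMod (2 * 2)) × Multiplicative (ZMod p)) := fun k =>
    Finset.univ.map ⟨fun v => (ofAdd (k v), ofAdd v), fun v w h => by simpa using congrArg Prod.snd h⟩ with hgr_def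
  have hgr : ∀ (k : ZMod p → ZMod (2 * 2)) (t : Multiplicative (ZMod (2 * 2))) (x : Multiplicative (ZMod p)),
      (t, x) ∈ gr k ↔ toAdd t = k (toAdd x) := fun k t x => by
    simp only [hgr_def, Finset.mem_map, Finset.mem_univ, true_and, Function.Embedding.coeFn_mk, Prod.mk.injEq]
    constructor
    · rintro ⟨w, h1, h2⟩
      rw [← h1, ← h2, toAdd_ofAdd, toAdd_ofAdd]
    · intro h
      exact ⟨toAdd x, by rw [← h, ofAdd_toAdd], ofAdd_toAdd x⟩
  have hgr_sum : ∀ (k : ZMod p → ZMod (2 * 2)) (g : Multiplicative (ZMod (2 * 2)) × Multiplicative (ZMod p) → ℂ),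
      ∑ w ∈ gr k, g w = ∑ v : ZMod p, g (ofAdd (k v), ofAdd v) := fun k g => by
    rw [hgr_def, Finset.sum_map]; rfl
  have h1ne : ∀ k : ZMod (2 * 2), k ≠ k + 1 := by decide
  have hgr_disj : ∀ k : ZMod p → ZMod (2 * 2), Disjoint (gr k) (gr fun v => k v + 1) := fun k => by
    rw [Finset.disjoint_left]
    rintro ⟨t, x⟩ h1 h2
    rw [hgr] at h1 h2
    exact h1ne _ (h1.symm.trans h2)
  have hS₁gr : S₁ = gr k₀ ∪ gr (fun v => k₀ v + 1) := by
    ext ⟨t, x⟩; rw [hmem₀, Finset.mem_union, hgr, hgr]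
  have hS₂gr : S₂ = gr k₁ ∪ gr (fun v => k₁ v + 1) := by
    ext ⟨t, x⟩; rw [hmem₁, Finset.mem_union, hgr, hgr]
  -- ===== the determinant never vanishes on odd characters =====
  have hdet : ∀ χ : AddChar (Additive (Multiplicative (ZMod (2 * 2)) × Multiplicative (ZMod p))) ℂ,
      χ (Additive.ofMul c) = -1 →
      (∑ s ∈ S₁, χ (Additive.ofMul s)) * (∑ s ∈ S₁, χ (Additive.ofMul (θ s))) -
        χ (Additive.ofMul q) * ((∑ t ∈ S₂, χ (Additive.ofMul t)) * (∑ t ∈ S₂, χ (Additive.ofMul (θ t)))) ≠ 0 := by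
    intro χ hχ hΔ
    simp_rw [hθ_apply] at hΔ
    -- `α = χ(1,0) = ±i`, `β = χ(0,1)`, `β^p = 1`
    set α : ℂ := χ (Additive.ofMul (ofAdd (1 : ZMod (2 * 2)), (1 : Multiplicative (ZMod p)))) with hα_def
    set β : ℂ := χ (Additive.ofMul ((1 : Multiplicative (ZMod (2 * 2))), ofAdd (1 : ZMod p))) with hβ_def
    have hαα : α * α = -1 := omega_mul_omega χ hχ
    obtain ⟨ε, hε, hα⟩ := exists_sign_of_mul_self_eq_neg_one hαα
    have hα4 : α ^ (2 * 2) = 1 := alpha_pow_four hε hα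
    have hβp : β ^ p = 1 := character_snd_pow_eq_one χ
    set ψ4 : AddChar (ZMod (2 * 2)) ℂ := zmodChar (2 * 2) hα4 with hψ4_def
    set ψp : AddChar (ZMod p) ℂ := zmodChar p hβp with hψp_def
    have hχv : ∀ (t : Multiplicative (ZMod (2 * 2))) (x : Multiplicative (ZMod p)),
        χ (Additive.ofMul (t, x)) = ψ4 (toAdd t) * ψp (toAdd x) := fun t x => by
      rw [character_eq_mul_pow, hψ4_def, hψp_def, zmodChar_apply, zmodChar_apply]
    have hψ41 : ψ4 1 = α := by rw [hψ4_def, zmodChar_apply, h1val, pow_one]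
    -- sheet sums `Ŝⱼ = (1 + α) Gⱼ`
    have hsheet : ∀ (k : ZMod p → ZMod (2 * 2)) (η : ZMod p → ℂ),
        ∑ w ∈ gr k ∪ gr (fun v => k v + 1), ψ4 (toAdd w.1) * η (toAdd w.2) =
        (1 + α) * ∑ v : ZMod p, ψ4 (k v) * η v := fun k η => by
      rw [Finset.sum_union (hgr_disj k), hgr_sum, hgr_sum, Finset.mul_sum, ← Finset.sum_add_distrib]
      refine Finset.sum_congr rfl fun v _ => ?_
      simp only [toAdd_ofAdd]
      rw [map_add_eq_mul, hψ41]; ring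
    have eA : ∑ s ∈ S₁, χ (Additive.ofMul s) = (1 + α) * ∑ v : ZMod p, ψ4 (k₀ v) * ψp v := by
      rw [hS₁gr, ← hsheet k₀ (fun v => ψp v)]
      exact Finset.sum_congr rfl fun w _ => hχv w.1 w.2
    have eAθ : ∑ s ∈ S₁, χ (Additive.ofMul (s.1, s.2⁻¹)) = (1 + α) * ∑ v : ZMod p, ψ4 (k₀ v) * ψp (-v) := by
      rw [hS₁gr, ← hsheet k₀ (fun v => ψp (-v))]
      exact Finset.sum_congr rfl fun w _ => by rw [hχv, toAdd_inv]
    have eB : ∑ s ∈ S₂, χ (Additive.ofMul s) = (1 + α) * ∑ v : ZMod p, ψ4 (k₁ v) * ψp v := by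
      rw [hS₂gr, ← hsheet k₁ (fun v => ψp v)]
      exact Finset.sum_congr rfl fun w _ => hχv w.1 w.2
    have eBθ : ∑ s ∈ S₂, χ (Additive.ofMul (s.1, s.2⁻¹)) = (1 + α) * ∑ v : ZMod p, ψ4 (k₁ v) * ψp (-v) := by
      rw [hS₂gr, ← hsheet k₁ (fun v => ψp (-v))]
      exact Finset.sum_congr rfl fun w _ => by rw [hχv, toAdd_inv]
    -- the core identity `G₀(β)G₀(β⁻¹) − α G₁(β)G₁(β⁻¹) = 0`
    have hα0 : α ≠ 0 := fun h => by rw [h, mul_zero] at hαα; norm_num at hαα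
    have h2α : (1 + α) ^ 2 ≠ 0 := by
      rw [show (1 + α) ^ 2 = 2 * α by linear_combination hαα]
      exact mul_ne_zero two_ne_zero hα0
    have hcore : (∑ v : ZMod p, ψ4 (k₀ v) * ψp v) * (∑ v : ZMod p, ψ4 (k₀ v) * ψp (-v)) -
        α * ((∑ v : ZMod p, ψ4 (k₁ v) * ψp v) * (∑ v : ZMod p, ψ4 (k₁ v) * ψp (-v))) = 0 := by
      rw [eA, eAθ, eB, eBθ] at hΔ
      have h : (1 + α) ^ 2 * ((∑ v : ZMod p, ψ4 (k₀ v) * ψp v) * (∑ v : ZMod p, ψ4 (k₀ v) * ψp (-v)) -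
          α * ((∑ v : ZMod p, ψ4 (k₁ v) * ψp v) * (∑ v : ZMod p, ψ4 (k₁ v) * ψp (-v)))) = 0 := by
        linear_combination hΔ
      exact (mul_eq_zero.1 h).resolve_left h2α
    by_cases hβ1 : β = 1
    · -- `χ` trivial on `ℤ/p`: parity
      have hψp1 : ∀ v : ZMod p, ψp v = 1 := fun v => by rw [hψp_def, zmodChar_apply, hβ1, one_pow]
      simp only [hψp1, mul_one] at hcore
      exact sum_psi_sq_ne hp2 hε hα k₀ k₁ hcore
    · -- `β` primitive: norm pair ⟹ `k₀` constant ⟹ `k₁` constant ⟹ `C_p` stabilises `S`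
      have hβprim : IsPrimitiveRoot β p := (IsPrimitiveRoot.iff_orderOf).2 (orderOf_eq_prime hβp hβ1)
      obtain ⟨hR, hI⟩ := normPair_of_det_eq_zero hp2 hε hα hβprim k₀ k₁ hcore
      have hk₀c : ∀ v, k₀ v = k₀ 0 := hNP k₀ k₁ hR hI
      have hψp_ne : ψp ≠ 1 := by
        intro h
        have h1 : ψp 1 = 1 := by rw [h, AddChar.one_apply]
        rw [hψp_def, zmodChar_apply, ZMod.val_one, pow_one] at h1
        exact hβ1 h1
      have hA₀ : ∑ v : ZMod p, ψ4 (k₀ v) * ψp v = 0 := by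
        simp_rw [hk₀c]
        rw [← Finset.mul_sum, AddChar.sum_eq_zero_of_ne_one hψp_ne, mul_zero]
      rw [hA₀, zero_mul, zero_sub, neg_eq_zero] at hcore
      have hk₁c : ∀ v, k₁ v = k₁ 0 := by
        rcases mul_eq_zero.1 ((mul_eq_zero.1 hcore).resolve_left hα0) with h | h
        · exact const_of_sheet_sum_eq_zero hp2 hε hα hβprim k₁ h
        · have h' : ∑ v : ZMod p, ψ4 (k₁ (-v)) * ψp v = 0 := by
            rw [← h]
            exact (Fintype.sum_equiv (Equiv.neg (ZMod p)) _ _ fun v => by simp)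
          have hc := const_of_sheet_sum_eq_zero hp2 hε hα hβprim (fun v => k₁ (-v)) h'
          intro v
          have := hc (-v)
          simp only [neg_neg, neg_zero] at this
          exact this
      -- `u⁴ = inl 4` stabilises `S`
      apply hstab
      intro w
      rw [← hγ4]
      rcases hcov w with ⟨u, rfl⟩ | ⟨u, rfl⟩
      · rw [← hS₁, hcomm, ← hS₁, hmem₀, hmem₀, hγ4_def, Prod.snd_mul, Prod.fst_mul, mul_one, hk₀c (toAdd u.2),
          hk₀c (toAdd (u.2 * _))]
      · rw [← hS₂, ← mul_assoc, hcomm, ← hS₂, hmem₁, hmem₁, hγ4_def, Prod.snd_mul, Prod.fst_mul, mul_one,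
          hk₁c (toAdd u.2), hk₁c (toAdd (u.2 * _))]
  exact TwoSheet.eq_zero_of_twoSheet i hi y hx hcov θ hθ q hyy hcc hθc S S₁ S₂ hS₁ hS₂ hdet b
    (fun g => by rw [hic]; exact hb g) hann

end Model

end Summit.HodgeConjecture.CorCM.GaloisCyclicSemidirectEight

end
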